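import Literature.AlgebraicGeometry.Resolution.FBlowupExistence
import Literature.AlgebraicGeometry.Resolution.FrobeniusNormFFinite
import Mathlib.AlgebraicGeometry.Morphisms.FiniteType
import Mathlib.AlgebraicGeometry.Noetherian
import HarnessLib

/-!
# F-blowups of varieties over perfect fields exist

Topic: `Literature/AlgebraicGeometry/Resolution`. The setting of T. Yasuda, *Universal flattening
of Frobenius*, Amer. J. Math. 134 (2012) = arXiv:0706.2700, §2 ("We work over a perfect field `k`
of characteristic `p > 0` … a variety means a separated integral scheme of finite type over a
field"): PROVED that **every integral scheme `X` locally of finite type over a perfect field `k` of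
characteristic `p` has an `e`-th F-blowup `π : FB_e(X) → X`** (`IsFBlowup`, `FBlowup.lean`), with
`FB_e(X)` integral and `π` proper and birational (Yasuda, Cor. 2.6).

* `expChar_functionField_of_hom` — the function field of an integral `k`-scheme has the
  (exponential) characteristic of `k`;
* `finiteType_sectionsMap` — the rings of sections `Γ(X, U)` of affine opens are `k`-algebras of
  finite type (`LocallyOfFiniteType`);
* `hasFrobeniusNormIdeals_of_locallyOfFiniteType` — hence F-finite (`FFinite.lean`), so Frobenius
  norm ideals exist on every nonempty affine open (`FrobeniusNormFFinite.lean`): the hypothesis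
  `HasFrobeniusNormIdeals` of `exists_isFBlowup` holds;
* `exists_isFBlowup_of_locallyOfFiniteType` — **existence of `FB_e(X) → X`**, and
  `exists_isFBlowup_integral_proper_birational` — with the properties of Yasuda, Cor. 2.6;
  `exists_isFBlowup_of_perfectField` — the same under `[Fact p.Prime] [CharP k p] [PerfectField k]`.

## Sources

* T. Yasuda, Amer. J. Math. 134 (2012) 349–378 = arXiv:0706.2700, §2: conventions, Def. 2.2,
  Prop. 2.3, Cor. 2.6. [Yasuda2012]
* O. Villamayor U., J. Algebra 295 (2006), Thm. 3.3, 3.4. [Villamayoru2006]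
-/

noncomputable section

open CategoryTheory CategoryTheory.Limits AlgebraicGeometry TopologicalSpace

namespace Literature.AlgebraicGeometry.Resolution

universe u

variable {k : Type u} [Field k] {X : Scheme.{u}}

/-- Over a field `k`, the ring of global sections of a nonempty integral `k`-scheme contains `k`;
in particular the **function field has the exponential characteristic of `k`**. [folklore] -/
theorem expChar_functionField_of_hom [IsIntegral X] (f : X ⟶ Spec (.of k)) (p : ℕ)
    [ExpChar k p] : ExpChar X.functionField p := by
  obtain ⟨x⟩ := (inferInstance : Nonempty X)
  haveI : Nonempty (⊤ : X.Opens) := ⟨⟨x, trivial⟩⟩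
  let φ : k →+* Γ(X, ⊤) := f.appTop.hom.comp (Scheme.ΓSpecIso (.of k)).inv.hom
  letI := φ.toAlgebra
  haveI : ExpChar Γ(X, ⊤) p := expChar_of_injective_algebraMap φ.injective p
  exact expChar_functionField ⊤ p

/-- The characteristic version: the function field of an integral `k`-scheme has the
characteristic of `k`. [folklore] -/
theorem charP_functionField_of_hom [IsIntegral X] (f : X ⟶ Spec (.of k)) (p : ℕ) [CharP k p] :
    CharP X.functionField p := by
  obtain ⟨x⟩ := (inferInstance : Nonempty X)
  haveI : Nonempty (⊤ : X.Opens) := ⟨⟨x, trivial⟩⟩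
  let φ : k →+* Γ(X, ⊤) := f.appTop.hom.comp (Scheme.ΓSpecIso (.of k)).inv.hom
  letI := φ.toAlgebra
  haveI : CharP Γ(X, ⊤) p := charP_of_injective_algebraMap φ.injective p
  exact charP_functionField ⊤ p

/-- **For `X` locally of finite type over `k`, the rings of sections of affine opens are
`k`-algebras of finite type** (through `sectionsMap f U : k → Γ(X, U)`). [folklore] -/
theorem finiteType_sectionsMap (f : X ⟶ Spec (.of k)) [LocallyOfFiniteType f]
    (U : X.affineOpens) : (sectionsMap f U).FiniteType := by
  have h1 : (f.appLE ⊤ U le_top).hom.FiniteType :=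
    HasRingHomProperty.appLE @LocallyOfFiniteType f inferInstance ⟨⊤, isAffineOpen_top _⟩ U le_top
  exact h1.comp (RingHom.FiniteType.of_surjective _
    (Scheme.ΓSpecIso (.of k)).symm.commRingCatIsoToRingEquiv.surjective)

/-- **Frobenius norm ideals exist on the affine opens of a scheme locally of finite type over a
perfect field** of characteristic `p`: the rings of sections `Γ(X, U)` are `k`-algebras of finite
type, hence F-finite (`isFFinite_of_finiteType_of_perfectRing`), and F-finite domains have
Frobenius norm ideals (`IsFFinite.exists_isFrobeniusNormIdeal`). This is why Yasuda's `𝒪_X^{1/q}`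
is coherent and `FB_e(X)` exists for varieties over perfect fields.
[cite: Yasuda2012, §2.1; Villamayoru2006, Thm. 3.3] -/
theorem hasFrobeniusNormIdeals_of_locallyOfFiniteType (p : ℕ) [ExpChar k p] [PerfectRing k p]
    (e : ℕ) [IsIntegral X] [ExpChar X.functionField p] (f : X ⟶ Spec (.of k))
    [LocallyOfFiniteType f] : HasFrobeniusNormIdeals p e X := by
  intro U hU
  haveI : IsFractionRing Γ(X, U) X.functionField :=
    functionField_isFractionRing_of_isAffineOpen X U U.2
  letI := (sectionsMap f U).toAlgebra
  haveI : Algebra.FiniteType k Γ(X, U) := finiteType_sectionsMap f U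
  exact ((isFFinite_of_perfectRing k p e).of_finiteType Γ(X, U)).exists_isFrobeniusNormIdeal

/-- **F-blowups of integral schemes locally of finite type over a perfect field exist** (Yasuda
2012, Def. 2.2 with Prop. 2.3 / Cor. 2.6, in the blow-up form of Villamayor 2006, 3.4): for
every `e` there is an `e`-th F-blowup `π : Y → X`.
[cite: Yasuda2012, Def. 2.2 and Cor. 2.6; Villamayoru2006, Thm. 3.3 and 3.4] -/
theorem exists_isFBlowup_of_locallyOfFiniteType (p : ℕ) [ExpChar k p] [PerfectRing k p] (e : ℕ)
    [IsIntegral X] [ExpChar X.functionField p] (f : X ⟶ Spec (.of k)) [LocallyOfFiniteType f] :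
    ∃ (Y : Scheme.{u}) (π : Y ⟶ X), IsFBlowup p e π :=
  exists_isFBlowup (hasFrobeniusNormIdeals_of_locallyOfFiniteType p e f)

/-- **Yasuda, Cor. 2.6 for the constructed F-blowup**: an integral scheme locally of finite type
over a perfect field of characteristic `p` has, for every `e`, an `e`-th F-blowup `π : Y → X`
with `Y` integral and `π` proper ("projective" in the source) and birational.
[cite: Yasuda2012, Cor. 2.6] -/
theorem exists_isFBlowup_integral_proper_birational (p : ℕ) [ExpChar k p] [PerfectRing k p]
    (e : ℕ) [IsIntegral X] [ExpChar X.functionField p] (f : X ⟶ Spec (.of k))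
    [LocallyOfFiniteType f] :
    ∃ (Y : Scheme.{u}) (π : Y ⟶ X), IsFBlowup p e π ∧ IsIntegral Y ∧ IsProper π ∧
      IsBirational π := by
  haveI : IsLocallyNoetherian X := LocallyOfFiniteType.isLocallyNoetherian f
  obtain ⟨Y, π, h⟩ := exists_isFBlowup_of_locallyOfFiniteType p e f
  exact ⟨Y, π, h, h.isIntegral, h.isProper, h.isBirational⟩

/-- **Consumer-facing form** (hypotheses as for a variety over a perfect field `k` of
characteristic `p`, `[Fact p.Prime] [CharP k p] [PerfectField k]`): an integral scheme locally of
finite type over `k` has, for every `e`, an `e`-th F-blowup `π : Y → X` with `Y` integral and `π`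
proper and birational; the characteristic instance of the function field is supplied by
`expChar_functionField_of_hom`. [cite: Yasuda2012, Def. 2.2 and Cor. 2.6] -/
theorem exists_isFBlowup_of_perfectField (p : ℕ) [Fact p.Prime] [CharP k p] [PerfectField k]
    (e : ℕ) [IsIntegral X] (f : X ⟶ Spec (.of k)) [LocallyOfFiniteType f] :
    haveI := expChar_functionField_of_hom f p
    ∃ (Y : Scheme.{u}) (π : Y ⟶ X), IsFBlowup p e π ∧ IsIntegral Y ∧ IsProper π ∧
      IsBirational π := by
  haveI := expChar_functionField_of_hom f p
  exact exists_isFBlowup_integral_proper_birational p e f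

end Literature.AlgebraicGeometry.Resolution

end
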